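import Literature.NumberTheory.GaloisRepresentations.IdeleProjection
import Literature.NumberTheory.GaloisRepresentations.IdeleTruncatedS
import HarnessLib

/-!
# The idèle projections at the places `v ∈ S` on Harari's `I_S = lim→_{E ⊂ K_S} J_{E,S}`, and `I_S` as a
# discrete `G_S`-module (Harari, *Galois Cohomology and CFT*, §17.4 (17.1), Prop. 17.26; Milne ADT I §4, Lemma 4.13)

Topic `NumberTheory/GaloisRepresentations`; namespaces `Literature.NumberTheory.GaloisRepresentations.IdeleClassBar`
(discreteness of `I_S`, next to `truncIdeleBarRep`) and `Literature.NumberTheory.GaloisRepresentations.IdeleReadout`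
(the projections, next to door-c6's `finIdelePi`).  Definitions with bodies and theorems; NO named fact, no `sorry`, no
instance, no notation; number fields in `Type`.

THE POINT.  The `S`-version of the idèle readout `Ext¹(M^D, J̄) = P¹(K, M)` (door-c6's `IdeleProjection.lean` /
`IdeleProjectionAssembly.lean`) reads a `G_S`-morphism `X → I_S` only at the places `v ∈ S`
[Harari Prop. 17.26: `Ext¹_{G_S}(M, I_S) ≅ P¹_S(k, M′) = ∏_{v ∈ S} H¹(k_v, M′)` for `S` finite].  The projections are NOT a
new construction: `π_v^S := π_v|_{I_S}` is door-c6's `finIdelePi v : J̄ → K̄_vˣ` restricted to the subgroup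
`I_S = IdeleClassBar.truncIdeleBar K S ≤ J̄` of `IdeleTruncatedS.lean`; it is `res_v`-equivariant for the `G_S`-action
along `Γ_{K_v} → Γ_K ↠ G_S` (`finIdelePiS_repr_mk`), and it VANISHES for `v ∉ S` (`finIdelePiS_eq_zero_of_not_mem`: a
truncated idèle has component `1` off `S`) — which is why only the places of `S` carry information.

## What is formalised (`K : Type` a number field, `S : Finset (HeightOneSpectrum (𝓞 K))`, `v : HeightOneSpectrum (𝓞 K)`)

* §1 `IdeleClassBar.toUnramifiedQuot_openNormalSubgroup_le_stabilizer`, **`isDiscrete_truncIdeleBarRep`** (every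
  stabiliser contains the open image of some `U_E`, `E ⊂ K_S`), **`truncIdeleBarD K S : DiscreteRepCat ℤ G_S`** (`I_S` as
  an object of door-c4's category `C_{G_S}`).
* §2 **`IdeleReadout.finIdelePiS K S v : ↥(truncIdeleBar K S) →+ UnitsCarrier (v.adicCompletion K)`** (`π_v|_{I_S}`),
  `finIdelePiS_apply`, `finIdelePiS_of` (value on `[x]_E`, `x ∈ J_{E,S}`), **`finIdelePiS_repr_mk`** (equivariance:
  `π_v ([res_v σ] • z) = σ • π_v z`), **`finIdelePiS_eq_zero_of_not_mem`** (`v ∉ S ⇒ π_v|_{I_S} = 0`).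
* §3 (appended) the same at the infinite places: `archIdelePiS K S v` (`v : InfinitePlace K`), `archIdelePiS_apply`,
  `archIdelePiS_of`, `archIdelePiS_repr_mk` — at the `Hom` level the archimedean components of `I_S` must be read too.

Written for lane «PT-Ш-S-TC» (brick D3) of crux `GoodLatticeBDPValue` (cell bsd-eis, item 19032), seat bsd-line-x1-p1-w6
gen 10, file 1 of the plan `D3-SCOPING-w6g10.md`.  HONEST FRAMING: module bookkeeping; the readout theorem
(`Hom_{G_S}(X, I_S)` versus families of local homomorphisms at `v ∈ S`, Harari Prop. 17.26) is NOT in this file, and no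
arithmetic statement / no case of BSD is proved here.

## References
* D. Harari, *Galois Cohomology and Class Field Theory*, Universitext, Springer (2020), §17.4 (17.1), Def. 17.22,
  Lemma 17.23, Prop. 17.26. [Harari2020]
* J. S. Milne, *Arithmetic Duality Theorems*, 2nd ed. (2006), I §4, Lemma 4.13. [MilneADT2006]
* J. W. S. Cassels, A. Fröhlich (eds.), *Algebraic Number Theory* (1967), Ch. VII (J. Tate) §7.3. [CasselsFrohlichANT1967]
-/

noncomputable section

open NumberField IsDedekindDomain Field CategoryTheory
open Literature.NumberTheory.Automorphic
open scoped Classical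

namespace Literature.NumberTheory.GaloisRepresentations

/-! ## §1. `I_S` is a discrete `G_S`-module -/

namespace IdeleClassBar

open Literature.Algebra.Homology

variable (K : Type) [Field K] [NumberField K] (S : Finset (HeightOneSpectrum (𝓞 K)))

/-- **The image of `U_E` in `G_S` stabilises `[x]_E`** (`E ⊂ K_S`, `x ∈ J_{E,S}`). [cite: Harari2020, §17.4 (17.1)] -/
theorem toUnramifiedQuot_openNormalSubgroup_le_stabilizer (E : GalLayer K)
    (hE : ramificationSubgroup K (↑S : Set (HeightOneSpectrum (𝓞 K))) ≤
      (E.openNormalSubgroup : Subgroup (absoluteGaloisGroup K)))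
    {x : (ideleData K).V E} (hx : haveI := E.numberField; (Additive.toMul x : ideleGroup E.1) ∈
      IdeleHerbrand.truncIdeles K E.1 S) :
    (E.openNormalSubgroup : Subgroup (absoluteGaloisGroup K)).map
        (toUnramifiedQuot K (↑S : Set (HeightOneSpectrum (𝓞 K)))) ≤
      DiscreteRep.stabilizer (truncIdeleBarRep K S)
        ⟨(ideleData K).toSystem.of E x, of_mem_truncIdeleBar E hE hx⟩ := by
  rintro _ ⟨σ, hσ, rfl⟩
  rw [DiscreteRep.mem_stabilizer_iff]
  exact Subtype.ext ((ideleData K).toSystem.rep_of_of_mem E hσ x)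

/-- **`I_S` is a discrete `G_S`-module**: the stabiliser of `[x]_E` contains the image of the open subgroup `U_E`, which is
open in the quotient `G_S = Γ_K ⧸ N_S`. [cite: Harari2020, §17.4 (17.1), §4.2 Remark 4.13] -/
theorem isDiscrete_truncIdeleBarRep : DiscreteRep.IsDiscrete (truncIdeleBarRep K S) := fun z => by
  obtain ⟨E, hE, x, hx, hz⟩ := mem_truncIdeleBar_iff.1 z.2
  have hz' : z = ⟨(ideleData K).toSystem.of E x, of_mem_truncIdeleBar E hE hx⟩ := Subtype.ext hz.symm
  rw [hz']
  exact Subgroup.isOpen_mono (toUnramifiedQuot_openNormalSubgroup_le_stabilizer K S E hE hx)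
    (QuotientGroup.isOpenMap_coe _ E.openNormalSubgroup.isOpen')

/-- **`I_S` as an object of `C_{G_S} = DiscreteRepCat ℤ G_S`.** [cite: Harari2020, §17.4 (17.1)] -/
abbrev truncIdeleBarD : DiscreteRepCat ℤ (GaloisGroupUnramifiedOutside K (↑S : Set (HeightOneSpectrum (𝓞 K)))) :=
  DiscreteRep.mk (truncIdeleBarRep K S) (isDiscrete_truncIdeleBarRep K S)

end IdeleClassBar

/-! ## §2. The projections `π_v|_{I_S}` -/

namespace IdeleReadout

open SemiLocal DiscreteGaloisModule IdeleClassBar HomDual Literature.Algebra.Homology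

variable (K : Type) [Field K] [NumberField K] (S : Finset (HeightOneSpectrum (𝓞 K))) (v : HeightOneSpectrum (𝓞 K))

/-- **`π_v^S := π_v|_{I_S} : I_S → K̄_vˣ`**, door-c6's `finIdelePi v` restricted to Harari's truncated idèles.
[cite: Harari2020, Prop. 17.26 (proof)] [cite: MilneADT2006, I Lemma 4.13 (proof)] -/
def finIdelePiS : truncIdeleBar K S →+ UnitsCarrier (v.adicCompletion K) :=
  (finIdelePi v).comp (truncIdeleBar K S).subtype

/-- Unfolding: `π_v^S z = π_v z`. [cite: Harari2020, Prop. 17.26 (proof)] -/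
@[simp]
theorem finIdelePiS_apply (z : truncIdeleBar K S) :
    finIdelePiS K S v z = finIdelePi v (z : (ideleData K).toSystem.limit) := rfl

/-- **`π_v^S [x]_E = π_v^{E} x`** for a truncated idèle `x ∈ J_{E,S}` of a layer `E ⊂ K_S`.
[cite: Harari2020, Prop. 17.26 (proof)] [cite: MilneADT2006, I Lemma 4.13 (proof)] -/
theorem finIdelePiS_of (E : GalLayer K)
    (hE : ramificationSubgroup K (↑S : Set (HeightOneSpectrum (𝓞 K))) ≤
      (E.openNormalSubgroup : Subgroup (absoluteGaloisGroup K)))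
    {x : (ideleData K).V E} (hx : haveI := E.numberField; (Additive.toMul x : ideleGroup E.1) ∈
      IdeleHerbrand.truncIdeles K E.1 S) :
    finIdelePiS K S v ⟨(ideleData K).toSystem.of E x, of_mem_truncIdeleBar E hE hx⟩ =
      (haveI := E.numberField; haveI := E.isGalois; idelePlaceReadout v (layerEmb E) x) :=
  finIdelePi_of v E x

/-- **`π_v^S` is `res_v`-equivariant for the `G_S`-action**: `π_v^S ([res_v σ] • z) = σ • π_v^S z`, `σ ∈ Γ_{K_v}`,
`[res_v σ]` the class of `res_v σ ∈ Γ_K` in `G_S`. [cite: Harari2020, Prop. 17.26 (proof)] [cite: MilneADT2006, I Lemma 4.13 (proof)] -/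
theorem finIdelePiS_repr_mk (σ : absoluteGaloisGroup (v.adicCompletion K)) (z : truncIdeleBar K S) :
    finIdelePiS K S v (truncIdeleBarRepr K S
        (QuotientGroup.mk (absGaloisRestrict K (v.adicCompletion K) σ)) z) =
      units (v.adicCompletion K) σ (finIdelePiS K S v z) :=
  finIdelePi_rep v σ z

/-- **`π_v^S = 0` for `v ∉ S`**: a truncated idèle has component `1` at the places not above `S`, so only the places of
`S` carry information (`P¹_S = ∏_{v ∈ S}`). [cite: Harari2020, Lemma 15.39, Prop. 17.26] -/
theorem finIdelePiS_eq_zero_of_not_mem (hv : v ∉ S) (z : truncIdeleBar K S) : finIdelePiS K S v z = 0 := by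
  obtain ⟨E, hE, x, hx, hz⟩ := mem_truncIdeleBar_iff.1 z.2
  haveI := E.numberField
  haveI := E.isGalois
  rw [finIdelePiS_apply, ← hz, finIdelePi_of]
  apply unitsVal_injective
  apply Units.ext
  rw [coe_unitsVal_idelePlaceReadout, show unitsVal (v.adicCompletion K) 0 = 1 from rfl, Units.val_one,
    hx _ (fun h => hv (by
      have h2 := (embPlace v (layerEmb E) : Place K E.1 v).2
      convert h using 1
      exact h2.symm)), map_one]

/-! ## §3. The projections at the infinite places (appended)

At the `Hom` level a `G_S`-morphism into `I_S` is read at the places of `S` AND at the infinite places (the truncated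
idèles keep their archimedean components); only after passing to `Ext¹` do the complex places drop out
(`H¹(ℂ, M) = 0`).  So the `S`-readout also needs door-c6's archimedean projections restricted to `I_S`. -/

section Infinite

variable (v : InfinitePlace K)

/-- **`π_v^S := π_v|_{I_S}` at an infinite place `v`**, door-c6's `archIdelePi v` restricted to `I_S`.
[cite: Harari2020, Prop. 17.26 (proof)] [cite: MilneADT2006, I Lemma 4.13 (proof)] -/
def archIdelePiS : truncIdeleBar K S →+ UnitsCarrier v.Completion :=
  (archIdelePi v).comp (truncIdeleBar K S).subtype

/-- Unfolding: `π_v^S z = π_v z`. [cite: Harari2020, Prop. 17.26 (proof)] -/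
@[simp]
theorem archIdelePiS_apply (z : truncIdeleBar K S) :
    archIdelePiS K S v z = archIdelePi v (z : (ideleData K).toSystem.limit) := rfl

/-- **`π_v^S [x]_E = π_v^{E} x`** at an infinite place, for a truncated idèle of a layer inside `K_S`.
[cite: Harari2020, Prop. 17.26 (proof)] [cite: MilneADT2006, I Lemma 4.13 (proof)] -/
theorem archIdelePiS_of (E : GalLayer K)
    (hE : ramificationSubgroup K (↑S : Set (HeightOneSpectrum (𝓞 K))) ≤
      (E.openNormalSubgroup : Subgroup (absoluteGaloisGroup K)))
    {x : (ideleData K).V E} (hx : haveI := E.numberField; (Additive.toMul x : ideleGroup E.1) ∈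
      IdeleHerbrand.truncIdeles K E.1 S) :
    archIdelePiS K S v ⟨(ideleData K).toSystem.of E x, of_mem_truncIdeleBar E hE hx⟩ =
      (haveI := E.numberField; haveI := E.isGalois; ideleInfPlaceReadout v (layerEmb E) x) :=
  archIdelePi_of v E x

/-- **`π_v^S` is `res_v`-equivariant at an infinite place** for the `G_S`-action.
[cite: Harari2020, Prop. 17.26 (proof)] [cite: MilneADT2006, I Lemma 4.13 (proof)] -/
theorem archIdelePiS_repr_mk (σ : absoluteGaloisGroup v.Completion) (z : truncIdeleBar K S) :
    archIdelePiS K S v (truncIdeleBarRepr K S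
        (QuotientGroup.mk (absGaloisRestrict K v.Completion σ)) z) =
      units v.Completion σ (archIdelePiS K S v z) :=
  archIdelePi_rep v σ z

end Infinite

end IdeleReadout

end Literature.NumberTheory.GaloisRepresentations

end
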